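import Literature.MathematicalPhysics.QuantumLattice.HubbardUVSymbolCTDifferences
import Literature.MathematicalPhysics.QuantumLattice.SectorisedKernelNorm
import Literature.MathematicalPhysics.QuantumLattice.ScaleCutoffs
import Literature.MathematicalPhysics.QuantumFieldTheory.Balaban1983to89.B12Profile270Bounds
import HarnessLib

/-!
# The padded scale-`0` SECTOR MULTIPLIER on the space–time dual torus `(ℤ/N) × (ℤ/L)²`: sup, support, and the second TIME
# differences with explicit constants (symbol layer of the sector-function `L¹` size `b₀` of the K3 engine's scale-`0` step)

Topic `MathematicalPhysics/QuantumLattice`; the sector-multiplier twin of `HubbardUVSymbolCTDifferences` (there: the padded symbol of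
the ultraviolet COVARIANCE of the counterterm carrier; here: the padded symbol of BGM's scale-`0` anisotropic sector MULTIPLIER
`F_ω(k) = H₀(|{-iω} + e_K(k⃗)|)·ζ_{0,ω}(θ(k⃗))`, `bgmMultiplier e₀ β e_K 0 ω`, (2.45)–(2.48)).  The `L¹` norms of the position-space sector
functions `F̌_ω` — the constant `b₀` of the cross-grid Young inequality (`HubbardGridSectorisedYoung`, `HubbardGridTransferProfile`,
`HubbardSectorGridOverlapReindex`) — are priced by weighted Plancherel from three data of the padded symbol
`G_ω(q₀, q⃗) = [val q₀ < 2M]·F_ω(⟨val q₀⟩, q⃗)` on the product torus `(ℤ/N) × (ℤ/L)²` (`2M ≤ N`): its sup, its support count, and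
POINTWISE single-direction second differences (`KLProgrammeKLRegimeTorusL1SecondDifferences.sum_norm_charSum_le_of_second_differences`).
This file supplies the sup, the support and the TIME direction, with explicit constants:

* `gnSqCutoff e₀ s = H₀(√s)` (`H₀ = gnCutoff 4 e₀`) with explicit first/second derivatives `gnSqCutoffD1/D2`, `HasDerivAt` everywhere
  (`H₀` is constant near `√s = 0`), and the bounds `|2·ψ′| ≤ 96/(9e₀²)`, `|4s·ψ″| ≤ 352/(9e₀²)` from `|H₀′| ≤ 8/(3e₀)`, `|H₀″| ≤ 256/(9e₀²)`
  (`|S′| ≤ 2`, `|S″| ≤ 16` for Mathlib's smooth transition, `B12Profile270Bounds`) and `H₀′ = H₀″ = 0` off `[e₀/4, e₀]`;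
* `cutoffFreqFn e₀ e ν = H₀(√(ν² + e²))` with `…D1/D2`, `HasDerivAt`, and **`abs_cutoffFreqFnD2_le : |∂²_ν| ≤ 448/(9e₀²)`**;
* `bgmGridSymbol` (the padded multiplier), `norm_bgmGridSymbol_le_one`, `bgmGridSymbol_eq_zero_of_le_abs_gridFreq` (`e₀ ≤ |ω̃| ⇒ 0`),
  `bgmGridSymbol_eq_zero_of_le_abs_band` (`e₀ ≤ |e_K| ⇒ 0`), `card_timeWindow_le` (`#{q₀ : val q₀ < 2M, |ω̃| < e₀} ≤ βe₀/π + 1`),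
  **`card_support_bgmGridSymbol_le`** (`#{G ≠ 0} ≤ (βe₀/π + 1)·N_k` given `#{q⃗ : |e_K| < e₀} ≤ N_k`);
* **`norm_fwdDiff_two_time_bgmGridSymbol_le`** — for EVERY `q₀` (`0 < β`, `2 ≤ M`, `2M ≤ N`, `e₀·β ≤ π(2M−3)`: the multiplier vanishes at
  the two lowest and the two highest Matsubara indices, so all edge and padding terms are ZERO):
  `‖(Δ_u)² G_ω(·,q⃗)(q₀)‖ ≤ (2π/β)²·448/(9e₀²)` (mean value twice, `norm_second_difference_le`).

Everything is proved; the definitions are the auxiliary one-variable functions and the padded symbol; no named facts.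

## Sources

G. Benfatto, A. Giuliani, V. Mastropietro, Ann. Henri Poincaré 7 (2006) 809–898, §2.2 (2.9), §2.5 (2.45)–(2.48), (2.36aa), §2.8 (2.81)
[`BenfattoGiulianiMastropietro2006`]; M. Salmhofer, *Renormalization* (1999), §4.2.4 (4.63) [`Salmhofer1999`].
-/

noncomputable section

namespace Literature.MathematicalPhysics.QuantumLattice

open Literature.Probability.LatticeModels Finset Complex Set
open Literature.MathematicalPhysics.QuantumFieldTheory.Balaban1983to89.B12Profile270Bounds

/-! ### §1 The scale-`0` cutoff `H₀ = gnCutoff 4 e₀`: explicit derivative bounds -/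

section Cutoff

variable {e₀ : ℝ}

/-- The derivative of `H₀(t) = S((e₀ − t)/(3e₀/4))`: `H₀′(t) = −S′(u)/(3e₀/4)`. [cite: BenfattoGiulianiMastropietro2006, §2.2 (2.9)] -/
theorem hasDerivAt_gnCutoff_four (e₀ t : ℝ) :
    HasDerivAt (gnCutoff 4 e₀)
      (deriv Real.smoothTransition ((e₀ - t) / (e₀ * (1 - (4 : ℝ)⁻¹))) * (-1 / (e₀ * (1 - (4 : ℝ)⁻¹)))) t := by
  have hlin : HasDerivAt (fun t : ℝ => (e₀ - t) / (e₀ * (1 - (4 : ℝ)⁻¹))) (-1 / (e₀ * (1 - (4 : ℝ)⁻¹))) t := by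
    have := ((hasDerivAt_const t e₀).sub (hasDerivAt_id t)).div_const (e₀ * (1 - (4 : ℝ)⁻¹))
    simpa using this
  exact (((Real.smoothTransition.contDiff (n := 1)).differentiable one_ne_zero _).hasDerivAt).comp t hlin

/-- `H₀′(t) = −S′((e₀ − t)/(3e₀/4))/(3e₀/4)`. [cite: BenfattoGiulianiMastropietro2006, §2.2 (2.9)] -/
theorem deriv_gnCutoff_four (e₀ t : ℝ) :
    deriv (gnCutoff 4 e₀) t = deriv Real.smoothTransition ((e₀ - t) / (e₀ * (1 - (4 : ℝ)⁻¹))) * (-1 / (e₀ * (1 - (4 : ℝ)⁻¹))) :=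
  (hasDerivAt_gnCutoff_four e₀ t).deriv

/-- **`|H₀′| ≤ 8/(3e₀)`** (`|S′| ≤ 2`). [cite: BenfattoGiulianiMastropietro2006, §2.2 (2.9)] -/
theorem abs_deriv_gnCutoff_four_le (he : 0 < e₀) (t : ℝ) : |deriv (gnCutoff 4 e₀) t| ≤ 8 / (3 * e₀) := by
  rw [deriv_gnCutoff_four, abs_mul]
  have h1 := abs_deriv_smoothTransition_le_two ((e₀ - t) / (e₀ * (1 - (4 : ℝ)⁻¹)))
  have h2 : |(-1 / (e₀ * (1 - (4 : ℝ)⁻¹)))| = 4 / (3 * e₀) := by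
    rw [abs_div, abs_neg, abs_one, abs_of_pos (by positivity)]
    field_simp
    norm_num
  rw [h2]
  calc |deriv Real.smoothTransition ((e₀ - t) / (e₀ * (1 - (4 : ℝ)⁻¹)))| * (4 / (3 * e₀)) ≤ 2 * (4 / (3 * e₀)) :=
        mul_le_mul_of_nonneg_right h1 (by positivity)
    _ = 8 / (3 * e₀) := by ring

/-- The second derivative: `H₀″(t) = S″(u)/(3e₀/4)²`. [cite: BenfattoGiulianiMastropietro2006, §2.2 (2.9)] -/
theorem hasDerivAt_deriv_gnCutoff_four (e₀ t : ℝ) :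
    HasDerivAt (deriv (gnCutoff 4 e₀))
      (deriv (deriv Real.smoothTransition) ((e₀ - t) / (e₀ * (1 - (4 : ℝ)⁻¹))) *
        (-1 / (e₀ * (1 - (4 : ℝ)⁻¹))) * (-1 / (e₀ * (1 - (4 : ℝ)⁻¹)))) t := by
  have hfun : deriv (gnCutoff 4 e₀) =
      fun t => deriv Real.smoothTransition ((e₀ - t) / (e₀ * (1 - (4 : ℝ)⁻¹))) * (-1 / (e₀ * (1 - (4 : ℝ)⁻¹))) :=
    funext (deriv_gnCutoff_four e₀)
  rw [hfun]
  have hlin : HasDerivAt (fun t : ℝ => (e₀ - t) / (e₀ * (1 - (4 : ℝ)⁻¹))) (-1 / (e₀ * (1 - (4 : ℝ)⁻¹))) t := by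
    have := ((hasDerivAt_const t e₀).sub (hasDerivAt_id t)).div_const (e₀ * (1 - (4 : ℝ)⁻¹))
    simpa using this
  have h1 : ContDiff ℝ 1 (deriv Real.smoothTransition) := by
    have h2 : ContDiff ℝ 2 Real.smoothTransition := Real.smoothTransition.contDiff
    rw [show (2 : WithTop ℕ∞) = 1 + 1 by norm_num] at h2
    exact (contDiff_succ_iff_deriv.1 h2).2.2
  have hd : HasDerivAt (deriv Real.smoothTransition) (deriv (deriv Real.smoothTransition) ((e₀ - t) / (e₀ * (1 - (4 : ℝ)⁻¹))))
      ((e₀ - t) / (e₀ * (1 - (4 : ℝ)⁻¹))) := (h1.differentiable one_ne_zero _).hasDerivAt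
  exact (hd.comp t hlin).mul_const _

/-- **`|H₀″| ≤ 256/(9e₀²)`** (`|S″| ≤ 16`). [cite: BenfattoGiulianiMastropietro2006, §2.2 (2.9)] -/
theorem abs_deriv_deriv_gnCutoff_four_le (he : 0 < e₀) (t : ℝ) : |deriv (deriv (gnCutoff 4 e₀)) t| ≤ 256 / (9 * e₀ ^ 2) := by
  rw [(hasDerivAt_deriv_gnCutoff_four e₀ t).deriv, abs_mul, abs_mul]
  have h1 := abs_deriv2_smoothTransition_le ((e₀ - t) / (e₀ * (1 - (4 : ℝ)⁻¹)))
  have h2 : |(-1 / (e₀ * (1 - (4 : ℝ)⁻¹)))| = 4 / (3 * e₀) := by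
    rw [abs_div, abs_neg, abs_one, abs_of_pos (by positivity)]
    field_simp
    norm_num
  rw [h2]
  calc |deriv (deriv Real.smoothTransition) ((e₀ - t) / (e₀ * (1 - (4 : ℝ)⁻¹)))| * (4 / (3 * e₀)) * (4 / (3 * e₀))
      ≤ 16 * (4 / (3 * e₀)) * (4 / (3 * e₀)) := by gcongr
    _ = 256 / (9 * e₀ ^ 2) := by field_simp; ring

/-- `H₀′ = 0` off `[e₀/4, e₀]`. [cite: BenfattoGiulianiMastropietro2006, §2.2 (2.9)] -/
theorem deriv_gnCutoff_four_eq_zero (he : 0 < e₀) {t : ℝ} (ht : t < e₀ / 4 ∨ e₀ < t) : deriv (gnCutoff 4 e₀) t = 0 := by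
  have h := iteratedDeriv_gnCutoff_eq_zero (γ := 4) (by norm_num) he (m := 1) one_ne_zero ht
  rwa [iteratedDeriv_one] at h

/-- `H₀″ = 0` off `[e₀/4, e₀]`. [cite: BenfattoGiulianiMastropietro2006, §2.2 (2.9)] -/
theorem deriv_deriv_gnCutoff_four_eq_zero (he : 0 < e₀) {t : ℝ} (ht : t < e₀ / 4 ∨ e₀ < t) :
    deriv (deriv (gnCutoff 4 e₀)) t = 0 := by
  have h := iteratedDeriv_gnCutoff_eq_zero (γ := 4) (by norm_num) he (m := 2) two_ne_zero ht
  rwa [iteratedDeriv_succ, iteratedDeriv_one] at h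

end Cutoff

/-! ### §2 `ψ(s) = H₀(√s)`: a `C²` function on all of `ℝ` with explicit derivatives -/

section SqCutoff

variable {e₀ : ℝ}

/-- `ψ(s) = H₀(√s)` (`H₀ = gnCutoff 4 e₀`). [cite: BenfattoGiulianiMastropietro2006, §2.3 (2.19)] -/
def gnSqCutoff (e₀ s : ℝ) : ℝ := gnCutoff 4 e₀ (Real.sqrt s)

/-- `ψ′(s) = H₀′(√s)/(2√s)`. [cite: BenfattoGiulianiMastropietro2006, §2.3 (2.19)] -/
def gnSqCutoffD1 (e₀ s : ℝ) : ℝ := deriv (gnCutoff 4 e₀) (Real.sqrt s) / (2 * Real.sqrt s)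

/-- `ψ″(s) = H₀″(√s)/(4s) − H₀′(√s)/(4s√s)`. [cite: BenfattoGiulianiMastropietro2006, §2.3 (2.19)] -/
def gnSqCutoffD2 (e₀ s : ℝ) : ℝ :=
  deriv (deriv (gnCutoff 4 e₀)) (Real.sqrt s) / (4 * s) - deriv (gnCutoff 4 e₀) (Real.sqrt s) / (4 * s * Real.sqrt s)

/-- Below `s = e₀²/16` the square root is below `e₀/4`, where `H₀` is flat. [folklore] -/
private theorem sqrt_lt_quarter (he : 0 < e₀) {s : ℝ} (hs : s < e₀ ^ 2 / 16) : Real.sqrt s < e₀ / 4 := by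
  rcases le_or_gt s 0 with h0 | h0
  · rw [Real.sqrt_eq_zero'.2 h0]; positivity
  · rw [show e₀ / 4 = Real.sqrt ((e₀ / 4) ^ 2) by rw [Real.sqrt_sq (by positivity)]]
    exact Real.sqrt_lt_sqrt h0.le (by nlinarith)

/-- `ψ = 1` on the open set `s < e₀²/16`. [cite: BenfattoGiulianiMastropietro2006, §2.2 (2.9)] -/
theorem gnSqCutoff_eq_one (he : 0 < e₀) {s : ℝ} (hs : s < e₀ ^ 2 / 16) : gnSqCutoff e₀ s = 1 := by
  rw [gnSqCutoff]
  exact gnCutoff_eq_one (γ := 4) (by norm_num) he (sqrt_lt_quarter he hs).le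

/-- `ψ′ = 0` on `s < e₀²/16`. [cite: BenfattoGiulianiMastropietro2006, §2.2 (2.9)] -/
theorem gnSqCutoffD1_eq_zero (he : 0 < e₀) {s : ℝ} (hs : s < e₀ ^ 2 / 16) : gnSqCutoffD1 e₀ s = 0 := by
  simp only [gnSqCutoffD1, deriv_gnCutoff_four_eq_zero he (Or.inl (sqrt_lt_quarter he hs)), zero_div]

/-- `ψ″ = 0` on `s < e₀²/16`. [cite: BenfattoGiulianiMastropietro2006, §2.2 (2.9)] -/
theorem gnSqCutoffD2_eq_zero (he : 0 < e₀) {s : ℝ} (hs : s < e₀ ^ 2 / 16) : gnSqCutoffD2 e₀ s = 0 := by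
  simp only [gnSqCutoffD2, deriv_gnCutoff_four_eq_zero he (Or.inl (sqrt_lt_quarter he hs)),
    deriv_deriv_gnCutoff_four_eq_zero he (Or.inl (sqrt_lt_quarter he hs))]
  simp

/-- `ψ′ = ψ″ = 0` beyond `s = e₀²` as well (there `√s > e₀` and `H₀ = 0` is flat). [cite: BenfattoGiulianiMastropietro2006, §2.2 (2.9)] -/
theorem gnSqCutoffD1_eq_zero_of_gt (he : 0 < e₀) {s : ℝ} (hs : e₀ ^ 2 < s) : gnSqCutoffD1 e₀ s = 0 := by
  have h : e₀ < Real.sqrt s := by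
    rw [show e₀ = Real.sqrt (e₀ ^ 2) by rw [Real.sqrt_sq he.le]]
    exact Real.sqrt_lt_sqrt (by positivity) hs
  simp only [gnSqCutoffD1, deriv_gnCutoff_four_eq_zero he (Or.inr h), zero_div]

/-- See `gnSqCutoffD1_eq_zero_of_gt`. [cite: BenfattoGiulianiMastropietro2006, §2.2 (2.9)] -/
theorem gnSqCutoffD2_eq_zero_of_gt (he : 0 < e₀) {s : ℝ} (hs : e₀ ^ 2 < s) : gnSqCutoffD2 e₀ s = 0 := by
  have h : e₀ < Real.sqrt s := by
    rw [show e₀ = Real.sqrt (e₀ ^ 2) by rw [Real.sqrt_sq he.le]]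
    exact Real.sqrt_lt_sqrt (by positivity) hs
  simp only [gnSqCutoffD2, deriv_gnCutoff_four_eq_zero he (Or.inr h), deriv_deriv_gnCutoff_four_eq_zero he (Or.inr h)]
  simp

/-- **`ψ′ = gnSqCutoffD1` everywhere.** [cite: BenfattoGiulianiMastropietro2006, §2.3 (2.19)] -/
theorem hasDerivAt_gnSqCutoff (he : 0 < e₀) (s : ℝ) : HasDerivAt (gnSqCutoff e₀) (gnSqCutoffD1 e₀ s) s := by
  rcases lt_or_ge s (e₀ ^ 2 / 16) with hs | hs
  · -- locally constant
    have hev : gnSqCutoff e₀ =ᶠ[nhds s] fun _ => (1 : ℝ) := by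
      filter_upwards [Iio_mem_nhds hs] with s' hs' using gnSqCutoff_eq_one he hs'
    rw [gnSqCutoffD1_eq_zero he hs]
    exact (hasDerivAt_const s (1 : ℝ)).congr_of_eventuallyEq hev
  · have hs0 : 0 < s := lt_of_lt_of_le (by positivity) hs
    have hsqrt : HasDerivAt Real.sqrt (1 / (2 * Real.sqrt s)) s := Real.hasDerivAt_sqrt hs0.ne'
    have hH : HasDerivAt (gnCutoff 4 e₀) (deriv (gnCutoff 4 e₀) (Real.sqrt s)) (Real.sqrt s) :=
      (hasDerivAt_gnCutoff_four e₀ _).differentiableAt.hasDerivAt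
    have h := hH.comp s hsqrt
    rw [gnSqCutoffD1, div_eq_mul_one_div]
    exact h

/-- **`ψ″ = gnSqCutoffD2` everywhere.** [cite: BenfattoGiulianiMastropietro2006, §2.3 (2.19)] -/
theorem hasDerivAt_gnSqCutoffD1 (he : 0 < e₀) (s : ℝ) : HasDerivAt (gnSqCutoffD1 e₀) (gnSqCutoffD2 e₀ s) s := by
  rcases lt_or_ge s (e₀ ^ 2 / 16) with hs | hs
  · have hev : gnSqCutoffD1 e₀ =ᶠ[nhds s] fun _ => (0 : ℝ) := by
      filter_upwards [Iio_mem_nhds hs] with s' hs' using gnSqCutoffD1_eq_zero he hs'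
    rw [gnSqCutoffD2_eq_zero he hs]
    exact (hasDerivAt_const s (0 : ℝ)).congr_of_eventuallyEq hev
  · have hs0 : 0 < s := lt_of_lt_of_le (by positivity) hs
    have hsq0 : 0 < Real.sqrt s := Real.sqrt_pos.2 hs0
    have hsqrt : HasDerivAt Real.sqrt (1 / (2 * Real.sqrt s)) s := Real.hasDerivAt_sqrt hs0.ne'
    -- `s ↦ H₀′(√s)`
    have hA : HasDerivAt (fun s => deriv (gnCutoff 4 e₀) (Real.sqrt s))
        (deriv (deriv (gnCutoff 4 e₀)) (Real.sqrt s) * (1 / (2 * Real.sqrt s))) s :=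
      ((hasDerivAt_deriv_gnCutoff_four e₀ _).differentiableAt.hasDerivAt).comp s hsqrt
    -- `s ↦ (2√s)⁻¹`
    have hB : HasDerivAt (fun s => (2 * Real.sqrt s)⁻¹) (-(2 * (1 / (2 * Real.sqrt s))) / (2 * Real.sqrt s) ^ 2) s :=
      (hsqrt.const_mul 2).inv (by positivity)
    have h := hA.mul hB
    have hfun : gnSqCutoffD1 e₀ = fun s => deriv (gnCutoff 4 e₀) (Real.sqrt s) * (2 * Real.sqrt s)⁻¹ := by
      funext s'; simp only [gnSqCutoffD1, div_eq_mul_inv]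
    rw [hfun]
    refine h.congr_deriv ?_
    show _ = deriv (deriv (gnCutoff 4 e₀)) (Real.sqrt s) / (4 * s) - deriv (gnCutoff 4 e₀) (Real.sqrt s) / (4 * s * Real.sqrt s)
    have hs_eq : s = Real.sqrt s ^ 2 := (Real.sq_sqrt hs0.le).symm
    generalize hr : Real.sqrt s = r at hsq0 hs_eq ⊢
    subst hs_eq
    field_simp
    ring

/-- **`|2ψ′(s)| ≤ 96/(9e₀²)`** (`H₀′(√s) ≠ 0` forces `√s ≥ e₀/4`). [cite: BenfattoGiulianiMastropietro2006, §2.5 Lemma 2.2] -/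
theorem abs_two_mul_gnSqCutoffD1_le (he : 0 < e₀) (s : ℝ) : |2 * gnSqCutoffD1 e₀ s| ≤ 96 / (9 * e₀ ^ 2) := by
  rcases lt_or_ge s (e₀ ^ 2 / 16) with hs | hs
  · rw [gnSqCutoffD1_eq_zero he hs, mul_zero, abs_zero]; positivity
  · have hs0 : 0 < s := lt_of_lt_of_le (by positivity) hs
    have hsq : e₀ / 4 ≤ Real.sqrt s := by
      rw [show e₀ / 4 = Real.sqrt ((e₀ / 4) ^ 2) by rw [Real.sqrt_sq (by positivity)]]
      exact Real.sqrt_le_sqrt (by nlinarith)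
    have hsq0 : 0 < Real.sqrt s := lt_of_lt_of_le (by positivity) hsq
    rw [gnSqCutoffD1, show 2 * (deriv (gnCutoff 4 e₀) (Real.sqrt s) / (2 * Real.sqrt s)) =
      deriv (gnCutoff 4 e₀) (Real.sqrt s) / Real.sqrt s by field_simp, abs_div, abs_of_pos hsq0, div_le_iff₀ hsq0]
    calc |deriv (gnCutoff 4 e₀) (Real.sqrt s)| ≤ 8 / (3 * e₀) := abs_deriv_gnCutoff_four_le he _
      _ = 96 / (9 * e₀ ^ 2) * (e₀ / 4) := by field_simp; ring
      _ ≤ 96 / (9 * e₀ ^ 2) * Real.sqrt s := mul_le_mul_of_nonneg_left hsq (by positivity)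

/-- **`|4s·ψ″(s)| ≤ 352/(9e₀²)`** (`= |H₀″(√s) − H₀′(√s)/√s|` with `√s ≥ e₀/4` where it is nonzero). [cite: BenfattoGiulianiMastropietro2006, §2.5 Lemma 2.2] -/
theorem abs_four_mul_mul_gnSqCutoffD2_le (he : 0 < e₀) (s : ℝ) : |4 * s * gnSqCutoffD2 e₀ s| ≤ 352 / (9 * e₀ ^ 2) := by
  rcases lt_or_ge s (e₀ ^ 2 / 16) with hs | hs
  · rw [gnSqCutoffD2_eq_zero he hs, mul_zero, abs_zero]; positivity
  · have hs0 : 0 < s := lt_of_lt_of_le (by positivity) hs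
    have hsq : e₀ / 4 ≤ Real.sqrt s := by
      rw [show e₀ / 4 = Real.sqrt ((e₀ / 4) ^ 2) by rw [Real.sqrt_sq (by positivity)]]
      exact Real.sqrt_le_sqrt (by nlinarith)
    have hsq0 : 0 < Real.sqrt s := lt_of_lt_of_le (by positivity) hsq
    have hform : 4 * s * gnSqCutoffD2 e₀ s =
        deriv (deriv (gnCutoff 4 e₀)) (Real.sqrt s) - deriv (gnCutoff 4 e₀) (Real.sqrt s) / Real.sqrt s := by
      rw [gnSqCutoffD2]
      field_simp
    rw [hform]
    have h1 := abs_deriv_deriv_gnCutoff_four_le he (Real.sqrt s)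
    have h2 : |deriv (gnCutoff 4 e₀) (Real.sqrt s) / Real.sqrt s| ≤ 96 / (9 * e₀ ^ 2) := by
      rw [abs_div, abs_of_pos hsq0, div_le_iff₀ hsq0]
      calc |deriv (gnCutoff 4 e₀) (Real.sqrt s)| ≤ 8 / (3 * e₀) := abs_deriv_gnCutoff_four_le he _
        _ = 96 / (9 * e₀ ^ 2) * (e₀ / 4) := by field_simp; ring
        _ ≤ 96 / (9 * e₀ ^ 2) * Real.sqrt s := mul_le_mul_of_nonneg_left hsq (by positivity)
    calc |deriv (deriv (gnCutoff 4 e₀)) (Real.sqrt s) - deriv (gnCutoff 4 e₀) (Real.sqrt s) / Real.sqrt s|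
        ≤ |deriv (deriv (gnCutoff 4 e₀)) (Real.sqrt s)| + |deriv (gnCutoff 4 e₀) (Real.sqrt s) / Real.sqrt s| := abs_sub _ _
      _ ≤ 256 / (9 * e₀ ^ 2) + 96 / (9 * e₀ ^ 2) := add_le_add h1 h2
      _ = 352 / (9 * e₀ ^ 2) := by ring

end SqCutoff

/-! ### §3 The cutoff as a function of the frequency at fixed band value: `φ_e(ν) = H₀(√(ν² + e²))` -/

section FreqFn

variable {e₀ : ℝ}

/-- `φ_e(ν) = H₀(√(ν² + e²))`. [cite: BenfattoGiulianiMastropietro2006, §2.3 (2.19)] -/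
def cutoffFreqFn (e₀ e ν : ℝ) : ℝ := gnSqCutoff e₀ (ν ^ 2 + e ^ 2)

/-- `φ_e′(ν) = ψ′(ν² + e²)·2ν`. [cite: BenfattoGiulianiMastropietro2006, §2.3 (2.19)] -/
def cutoffFreqFnD1 (e₀ e ν : ℝ) : ℝ := gnSqCutoffD1 e₀ (ν ^ 2 + e ^ 2) * (2 * ν)

/-- `φ_e″(ν) = ψ″(ν²+e²)·(2ν)² + 2ψ′(ν²+e²)`. [cite: BenfattoGiulianiMastropietro2006, §2.3 (2.19)] -/
def cutoffFreqFnD2 (e₀ e ν : ℝ) : ℝ := gnSqCutoffD2 e₀ (ν ^ 2 + e ^ 2) * (2 * ν) * (2 * ν) + gnSqCutoffD1 e₀ (ν ^ 2 + e ^ 2) * 2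

/-- `d/dν (ν² + e²) = 2ν`. [folklore] -/
private theorem hasDerivAt_sq_add (e ν : ℝ) : HasDerivAt (fun ν : ℝ => ν ^ 2 + e ^ 2) (2 * ν) ν := by
  simpa using ((hasDerivAt_pow 2 ν).add_const (e ^ 2))

/-- `φ_e′ = cutoffFreqFnD1`. [cite: BenfattoGiulianiMastropietro2006, §2.3 (2.19)] -/
theorem hasDerivAt_cutoffFreqFn (he : 0 < e₀) (e ν : ℝ) : HasDerivAt (cutoffFreqFn e₀ e) (cutoffFreqFnD1 e₀ e ν) ν := by
  unfold cutoffFreqFn cutoffFreqFnD1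
  exact (hasDerivAt_gnSqCutoff he _).comp ν (hasDerivAt_sq_add e ν)

/-- `φ_e″ = cutoffFreqFnD2`. [cite: BenfattoGiulianiMastropietro2006, §2.3 (2.19)] -/
theorem hasDerivAt_cutoffFreqFnD1 (he : 0 < e₀) (e ν : ℝ) : HasDerivAt (cutoffFreqFnD1 e₀ e) (cutoffFreqFnD2 e₀ e ν) ν := by
  unfold cutoffFreqFnD1 cutoffFreqFnD2
  have h1 : HasDerivAt (fun ν => gnSqCutoffD1 e₀ (ν ^ 2 + e ^ 2)) (gnSqCutoffD2 e₀ (ν ^ 2 + e ^ 2) * (2 * ν)) ν :=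
    (hasDerivAt_gnSqCutoffD1 he _).comp ν (hasDerivAt_sq_add e ν)
  have h2 : HasDerivAt (fun ν : ℝ => 2 * ν) 2 ν := by simpa using (hasDerivAt_id ν).const_mul 2
  exact h1.mul h2

/-- `|φ_e| ≤ 1`. [cite: BenfattoGiulianiMastropietro2006, §2.2 (2.9)] -/
theorem abs_cutoffFreqFn_le_one (e₀ e ν : ℝ) : |cutoffFreqFn e₀ e ν| ≤ 1 := by
  have h := gnCutoff_mem_Icc 4 e₀ (Real.sqrt (ν ^ 2 + e ^ 2))
  rw [cutoffFreqFn, gnSqCutoff, abs_of_nonneg h.1]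
  exact h.2

/-- **`|φ_e″(ν)| ≤ 448/(9e₀²)`** for all `ν`: `|4ν²ψ″(s)| ≤ |4sψ″(s)| ≤ 352/(9e₀²)` (`ν² ≤ s = ν² + e²`) and `|2ψ′| ≤ 96/(9e₀²)`.
[cite: BenfattoGiulianiMastropietro2006, §2.5 Lemma 2.2] -/
theorem abs_cutoffFreqFnD2_le (he : 0 < e₀) (e ν : ℝ) : |cutoffFreqFnD2 e₀ e ν| ≤ 448 / (9 * e₀ ^ 2) := by
  set s := ν ^ 2 + e ^ 2 with hs
  have hνs : ν ^ 2 ≤ s := by rw [hs]; nlinarith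
  have h1 : |gnSqCutoffD2 e₀ s * (2 * ν) * (2 * ν)| ≤ 352 / (9 * e₀ ^ 2) := by
    have h4 := abs_four_mul_mul_gnSqCutoffD2_le he s
    have hs0 : 0 ≤ s := by rw [hs]; positivity
    calc |gnSqCutoffD2 e₀ s * (2 * ν) * (2 * ν)| = 4 * ν ^ 2 * |gnSqCutoffD2 e₀ s| := by
          rw [show gnSqCutoffD2 e₀ s * (2 * ν) * (2 * ν) = (4 * ν ^ 2) * gnSqCutoffD2 e₀ s by ring, abs_mul,
            abs_of_nonneg (by positivity : (0 : ℝ) ≤ 4 * ν ^ 2)]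
      _ ≤ 4 * s * |gnSqCutoffD2 e₀ s| := by gcongr
      _ = |4 * s * gnSqCutoffD2 e₀ s| := by rw [abs_mul, abs_of_nonneg (by positivity : (0:ℝ) ≤ 4 * s)]
      _ ≤ 352 / (9 * e₀ ^ 2) := h4
  have h2 : |gnSqCutoffD1 e₀ s * 2| ≤ 96 / (9 * e₀ ^ 2) := by
    rw [mul_comm]; exact abs_two_mul_gnSqCutoffD1_le he s
  calc |cutoffFreqFnD2 e₀ e ν| ≤ |gnSqCutoffD2 e₀ s * (2 * ν) * (2 * ν)| + |gnSqCutoffD1 e₀ s * 2| := abs_add_le _ _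
    _ ≤ 352 / (9 * e₀ ^ 2) + 96 / (9 * e₀ ^ 2) := add_le_add h1 h2
    _ = 448 / (9 * e₀ ^ 2) := by ring

/-- `φ_e(ν) = 0` when `e₀ ≤ |ν|` (then `√(ν² + e²) ≥ e₀`). [cite: BenfattoGiulianiMastropietro2006, §2.2 (2.9)] -/
theorem cutoffFreqFn_eq_zero_of_le_abs (he : 0 < e₀) {e ν : ℝ} (hν : e₀ ≤ |ν|) : cutoffFreqFn e₀ e ν = 0 := by
  rw [cutoffFreqFn, gnSqCutoff]
  refine gnCutoff_eq_zero (γ := 4) (by norm_num) he ?_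
  calc e₀ ≤ |ν| := hν
    _ = Real.sqrt (ν ^ 2) := (Real.sqrt_sq_eq_abs ν).symm
    _ ≤ Real.sqrt (ν ^ 2 + e ^ 2) := Real.sqrt_le_sqrt (by nlinarith)

/-- `φ_e(ν) = 0` when `e₀ ≤ |e|`. [cite: BenfattoGiulianiMastropietro2006, §2.2 (2.9)] -/
theorem cutoffFreqFn_eq_zero_of_le_abs_band (he : 0 < e₀) {e ν : ℝ} (hb : e₀ ≤ |e|) : cutoffFreqFn e₀ e ν = 0 := by
  rw [cutoffFreqFn, gnSqCutoff]
  refine gnCutoff_eq_zero (γ := 4) (by norm_num) he ?_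
  calc e₀ ≤ |e| := hb
    _ = Real.sqrt (e ^ 2) := (Real.sqrt_sq_eq_abs e).symm
    _ ≤ Real.sqrt (ν ^ 2 + e ^ 2) := Real.sqrt_le_sqrt (by nlinarith)

end FreqFn

/-! ### §4 The padded scale-`0` multiplier symbol on `(ℤ/N) × (ℤ/L)²` -/

section Symbol

variable (L M N : ℕ) [NeZero L]

/-- **The padded scale-`0` sector multiplier** on the product torus: `G_ω(q₀, q⃗) = F_ω(⟨val q₀⟩, q⃗)` for `val q₀ < 2M` and `0` beyond,
`F_ω = bgmMultiplier e₀ β e_K 0 ω`, `e_K = nambuXiCT L μ K`. [cite: BenfattoGiulianiMastropietro2006, §2.5 (2.48)] -/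
def bgmGridSymbol (e₀ β μ : ℝ) (K : TrigPolyC4v) (ω : Fin (sectorCount 0)) (q₀ : TorusSite 1 N) (qv : TorusSite 2 L) : ℂ :=
  if h : (q₀ 0).val < 2 * M then bgmMultiplier L M e₀ β (nambuXiCT L μ K) 0 ω (⟨(q₀ 0).val, h⟩, qv) else 0

variable {L M N}

omit [NeZero L] in
/-- **The padded symbol in closed form**: `G_ω(q₀, q⃗) = [val q₀ < 2M]·φ_{e_K(q⃗)}(ω̃_{q₀})·ζ_{0,ω}(θ(q⃗))`.
[cite: BenfattoGiulianiMastropietro2006, §2.5 (2.48)] -/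
theorem bgmGridSymbol_eq (e₀ β μ : ℝ) (K : TrigPolyC4v) (ω : Fin (sectorCount 0)) (q₀ : TorusSite 1 N) (qv : TorusSite 2 L) :
    bgmGridSymbol L M N e₀ β μ K ω q₀ qv = if (q₀ 0).val < 2 * M then
      (((cutoffFreqFn e₀ (nambuXiCT L μ K qv) (gridFreq M N β q₀) *
        sectorWeightCirc 0 ω (momentumAngle L qv) : ℝ)) : ℂ) else 0 := by
  unfold bgmGridSymbol
  split_ifs with h
  · rw [bgmMultiplier, ← matsubaraFreq_eq_gridFreq β q₀ h, cutoffFreqFn, gnSqCutoff, gnScaleCutoff]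
    simp
  · rfl

omit [NeZero L] in
/-- `‖G_ω‖ ≤ 1`. [cite: BenfattoGiulianiMastropietro2006, §2.5 (2.48)] -/
theorem norm_bgmGridSymbol_le_one (e₀ β μ : ℝ) (K : TrigPolyC4v) (ω : Fin (sectorCount 0)) (q₀ : TorusSite 1 N)
    (qv : TorusSite 2 L) : ‖bgmGridSymbol L M N e₀ β μ K ω q₀ qv‖ ≤ 1 := by
  unfold bgmGridSymbol
  split_ifs with h
  · exact norm_bgmMultiplier_le_one e₀ β _ 0 ω _
  · simp

omit [NeZero L] in
/-- `G_ω(q₀, q⃗) = 0` once `e₀ ≤ |ω̃_{q₀}|`. [cite: BenfattoGiulianiMastropietro2006, §2.2 (2.9)] -/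
theorem bgmGridSymbol_eq_zero_of_le_abs_gridFreq {e₀ : ℝ} (he : 0 < e₀) (β μ : ℝ) (K : TrigPolyC4v)
    (ω : Fin (sectorCount 0)) {q₀ : TorusSite 1 N} (hq : e₀ ≤ |gridFreq M N β q₀|) (qv : TorusSite 2 L) :
    bgmGridSymbol L M N e₀ β μ K ω q₀ qv = 0 := by
  rw [bgmGridSymbol_eq]
  split_ifs with h
  · rw [cutoffFreqFn_eq_zero_of_le_abs he hq, zero_mul, Complex.ofReal_zero]
  · rfl

omit [NeZero L] in
/-- `G_ω(q₀, q⃗) = 0` once `e₀ ≤ |e_K(q⃗)|`. [cite: BenfattoGiulianiMastropietro2006, §2.2 (2.9)] -/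
theorem bgmGridSymbol_eq_zero_of_le_abs_band {e₀ : ℝ} (he : 0 < e₀) (β μ : ℝ) (K : TrigPolyC4v) (ω : Fin (sectorCount 0))
    (q₀ : TorusSite 1 N) {qv : TorusSite 2 L} (hb : e₀ ≤ |nambuXiCT L μ K qv|) : bgmGridSymbol L M N e₀ β μ K ω q₀ qv = 0 := by
  rw [bgmGridSymbol_eq]
  split_ifs with h
  · rw [cutoffFreqFn_eq_zero_of_le_abs_band he hb, zero_mul, Complex.ofReal_zero]
  · rfl

/-! #### The support: a frequency window times a band shell -/

/-- **The frequency window has at most `βe₀/π + 1` points**: `#{q₀ : val q₀ < 2M ∧ |ω̃_{q₀}| < e₀} ≤ βe₀/π + 1` (`0 < β`; consecutive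
padded frequencies differ by `2π/β`, all lie in `(−e₀, e₀)`). [cite: Salmhofer1999, §4.2.4 (4.63)] -/
theorem card_timeWindow_le [NeZero N] {β e₀ : ℝ} (hβ : 0 < β) (he : 0 ≤ e₀) :
    (((univ : Finset (TorusSite 1 N)).filter fun q₀ => (q₀ 0).val < 2 * M ∧ |gridFreq M N β q₀| < e₀).card : ℝ) ≤
      β * e₀ / Real.pi + 1 := by
  classical
  set W := (univ : Finset (TorusSite 1 N)).filter fun q₀ => (q₀ 0).val < 2 * M ∧ |gridFreq M N β q₀| < e₀ with hW
  rcases W.eq_empty_or_nonempty with hE | hne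
  · rw [hE, Finset.card_empty, Nat.cast_zero]; positivity
  · -- the values of `W` lie between those of its min and max (by `val`), which are `< βe₀/π` apart
    have hneI : (W.image fun q₀ : TorusSite 1 N => (q₀ 0).val).Nonempty := hne.image _
    set vmin := (W.image fun q₀ : TorusSite 1 N => (q₀ 0).val).min' hneI with hvmin
    set vmax := (W.image fun q₀ : TorusSite 1 N => (q₀ 0).val).max' hneI with hvmax
    have hinj : Set.InjOn (fun q₀ : TorusSite 1 N => (q₀ 0).val) W := fun q _ q' _ h =>
      torusSite_one_ext (ZMod.val_injective _ h)
    have hcardW : W.card = (W.image fun q₀ : TorusSite 1 N => (q₀ 0).val).card := (Finset.card_image_of_injOn hinj).symm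
    have hsub : (W.image fun q₀ : TorusSite 1 N => (q₀ 0).val) ⊆ Finset.Icc vmin vmax := fun v hv =>
      Finset.mem_Icc.2 ⟨Finset.min'_le _ _ hv, Finset.le_max' _ _ hv⟩
    have hmin_mem : vmin ∈ W.image fun q₀ : TorusSite 1 N => (q₀ 0).val := Finset.min'_mem _ hneI
    have hmax_mem : vmax ∈ W.image fun q₀ : TorusSite 1 N => (q₀ 0).val := Finset.max'_mem _ hneI
    obtain ⟨qmin, hqmin, hqminv⟩ := Finset.mem_image.1 hmin_mem
    obtain ⟨qmax, hqmax, hqmaxv⟩ := Finset.mem_image.1 hmax_mem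
    have h1 := (Finset.mem_filter.1 hqmin).2.2
    have h2 := (Finset.mem_filter.1 hqmax).2.2
    have hle : vmin ≤ vmax := Finset.min'_le _ _ hmax_mem
    -- `ω̃(qmax) − ω̃(qmin) = 2π(vmax − vmin)/β < 2e₀`
    have hdiff : gridFreq M N β qmax - gridFreq M N β qmin = 2 * Real.pi * ((vmax : ℝ) - vmin) / β := by
      simp only [gridFreq, ← hqminv, ← hqmaxv]
      field_simp
      ring
    have hlt : 2 * Real.pi * ((vmax : ℝ) - vmin) / β < 2 * e₀ := by
      rw [← hdiff]
      have := abs_lt.1 h1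
      have := abs_lt.1 h2
      linarith
    have hgap : ((vmax : ℝ) - vmin) < β * e₀ / Real.pi := by
      rw [lt_div_iff₀ Real.pi_pos]
      rw [div_lt_iff₀ hβ] at hlt
      nlinarith [Real.pi_pos]
    calc (W.card : ℝ) = ((W.image fun q₀ : TorusSite 1 N => (q₀ 0).val).card : ℝ) := by rw [hcardW]
      _ ≤ ((Finset.Icc vmin vmax).card : ℝ) := by exact_mod_cast Finset.card_le_card hsub
      _ = ((vmax + 1 - vmin : ℕ) : ℝ) := by rw [Nat.card_Icc]
      _ = (vmax : ℝ) + 1 - vmin := by rw [Nat.cast_sub (by omega), Nat.cast_add, Nat.cast_one]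
      _ ≤ β * e₀ / Real.pi + 1 := by linarith

/-- **The support of the padded multiplier is a window times a shell**: if `#{q⃗ : |e_K(q⃗)| < e₀} ≤ N_k` then
`#{(q₀,q⃗) : G_ω ≠ 0} ≤ (βe₀/π + 1)·N_k`. [cite: BenfattoGiulianiMastropietro2006, §2.8 (2.81)] -/
theorem card_support_bgmGridSymbol_le [NeZero N] {e₀ β : ℝ} (he : 0 < e₀) (hβ : 0 < β) (μ : ℝ) (K : TrigPolyC4v)
    (ω : Fin (sectorCount 0)) {Nk : ℕ} (hNk : ((univ : Finset (TorusSite 2 L)).filter fun qv => |nambuXiCT L μ K qv| < e₀).card ≤ Nk) :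
    (((univ : Finset (TorusSite 1 N × TorusSite 2 L)).filter fun q => bgmGridSymbol L M N e₀ β μ K ω q.1 q.2 ≠ 0).card : ℝ) ≤
      (β * e₀ / Real.pi + 1) * Nk := by
  classical
  set W := (univ : Finset (TorusSite 1 N)).filter fun q₀ => (q₀ 0).val < 2 * M ∧ |gridFreq M N β q₀| < e₀ with hW
  set S := (univ : Finset (TorusSite 2 L)).filter fun qv => |nambuXiCT L μ K qv| < e₀ with hS
  have hsub : ((univ : Finset (TorusSite 1 N × TorusSite 2 L)).filter fun q => bgmGridSymbol L M N e₀ β μ K ω q.1 q.2 ≠ 0) ⊆ W ×ˢ S := by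
    intro q hq
    have hne := (mem_filter.1 hq).2
    refine mem_product.2 ⟨mem_filter.2 ⟨mem_univ _, ?_, ?_⟩, mem_filter.2 ⟨mem_univ _, ?_⟩⟩
    · by_contra h
      exact hne (by unfold bgmGridSymbol; rw [dif_neg h])
    · by_contra h
      exact hne (bgmGridSymbol_eq_zero_of_le_abs_gridFreq he β μ K ω (not_lt.1 h) q.2)
    · by_contra h
      exact hne (bgmGridSymbol_eq_zero_of_le_abs_band he β μ K ω q.1 (not_lt.1 h))
  calc (((univ : Finset (TorusSite 1 N × TorusSite 2 L)).filter fun q => bgmGridSymbol L M N e₀ β μ K ω q.1 q.2 ≠ 0).card : ℝ)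
      ≤ ((W ×ˢ S).card : ℝ) := by exact_mod_cast Finset.card_le_card hsub
    _ = (W.card : ℝ) * S.card := by rw [Finset.card_product, Nat.cast_mul]
    _ ≤ (β * e₀ / Real.pi + 1) * Nk := by
        refine mul_le_mul (card_timeWindow_le hβ he.le) (by exact_mod_cast hNk) (by positivity) (by positivity)

/-! #### The second TIME differences (all edge and padding terms vanish) -/

omit [NeZero L] in
/-- At the two lowest and the two highest Matsubara indices (and in the padding) the multiplier VANISHES once `e₀β ≤ π(2M−3)`:
`val q₀ ≤ 1 ∨ 2M−2 ≤ val q₀ ⇒ G_ω(q₀, q⃗) = 0`. [cite: Salmhofer1999, §4.2.4 (4.63)] -/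
theorem bgmGridSymbol_eq_zero_of_edge {e₀ β : ℝ} (he : 0 < e₀) (hβ : 0 < β) (hM : e₀ * β ≤ Real.pi * (2 * M - 3)) (μ : ℝ)
    (K : TrigPolyC4v) (ω : Fin (sectorCount 0)) {q₀ : TorusSite 1 N} (hq : (q₀ 0).val ≤ 1 ∨ 2 * M - 2 ≤ (q₀ 0).val)
    (qv : TorusSite 2 L) : bgmGridSymbol L M N e₀ β μ K ω q₀ qv = 0 := by
  refine bgmGridSymbol_eq_zero_of_le_abs_gridFreq he β μ K ω ((le_trans ?_ (abs_gridFreq_ge hβ q₀ hq))) qv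
  rw [le_div_iff₀ hβ]
  exact hM

omit [NeZero L] in
/-- **The second time difference of the padded multiplier, every `q₀`**: for `0 < β`, `0 < e₀`, `2 ≤ M`, `2M ≤ N` and
`e₀β ≤ π(2M−3)`, `‖(Δ_u)² G_ω(·, q⃗)(q₀)‖ ≤ (2π/β)²·448/(9e₀²)` (`u = 1 ∈ ℤ/N`): in the interior `val q₀ + 2 < 2M` this is the mean value
theorem twice on `φ_{e_K(q⃗)}` times `|ζ| ≤ 1`; elsewhere all three values vanish. [cite: BenfattoGiulianiMastropietro2006, (2.36aa)] -/
theorem norm_fwdDiff_two_time_bgmGridSymbol_le [NeZero N] {e₀ β : ℝ} (he : 0 < e₀) (hβ : 0 < β) (hM2 : 2 ≤ M) (hMN : 2 * M ≤ N)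
    (hM : e₀ * β ≤ Real.pi * (2 * M - 3)) (μ : ℝ) (K : TrigPolyC4v) (ω : Fin (sectorCount 0)) (q₀ : TorusSite 1 N)
    (qv : TorusSite 2 L) :
    ‖(fwdDiff (fun _ : Fin 1 => (1 : ZMod N)))^[2] (fun q => bgmGridSymbol L M N e₀ β μ K ω q qv) q₀‖ ≤
      (2 * Real.pi / β) ^ 2 * (448 / (9 * e₀ ^ 2)) := by
  set e := nambuXiCT L μ K qv with he'
  set ζ := sectorWeightCirc 0 ω (momentumAngle L qv) with hζ
  have hζ1 : |ζ| ≤ 1 := by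
    rw [abs_of_nonneg (sectorWeightCirc_nonneg 0 _ _)]
    exact sectorWeightCirc_le_one 0 _ _
  rw [fwdDiff_iter_two_apply]
  by_cases hint : (q₀ 0).val + 2 < 2 * M
  · -- interior: the three indices are `val q₀, +1, +2 < 2M ≤ N`
    have h0 : (q₀ 0).val < 2 * M := by omega
    have h1N : (q₀ 0).val + 1 < N := by omega
    have h2N : (q₀ 0).val + 2 < N := by omega
    have hv1 : ((q₀ + 1 • (fun _ : Fin 1 => (1 : ZMod N))) 0).val < 2 * M := by
      rw [val_add_smul_timeStep q₀ (by omega), Nat.mod_eq_of_lt h1N]; omega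
    have hv2 : ((q₀ + 2 • (fun _ : Fin 1 => (1 : ZMod N))) 0).val < 2 * M := by
      rw [val_add_smul_timeStep q₀ (by omega), Nat.mod_eq_of_lt h2N]; omega
    rw [bgmGridSymbol_eq, bgmGridSymbol_eq, bgmGridSymbol_eq, if_pos hv2, if_pos hv1, if_pos h0,
      gridFreq_add_smul β q₀ 2 h2N, gridFreq_add_smul β q₀ 1 h1N, ← he', ← hζ]
    set ν := gridFreq M N β q₀ with hν
    set δ := 2 * Real.pi / β with hδ
    have hδ0 : 0 ≤ δ := by positivity
    -- the complex expression is the real second difference times `ζ`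
    have hreal : (((cutoffFreqFn e₀ e (ν + (2 : ℕ) * δ) * ζ : ℝ)) : ℂ) - (2 : ℤ) • (((cutoffFreqFn e₀ e (ν + (1 : ℕ) * δ) * ζ : ℝ)) : ℂ) +
        (((cutoffFreqFn e₀ e ν * ζ : ℝ)) : ℂ) =
        (((cutoffFreqFn e₀ e (ν + 2 * δ) - (2 : ℝ) • cutoffFreqFn e₀ e (ν + δ) + cutoffFreqFn e₀ e ν) * ζ : ℝ) : ℂ) := by
      simp only [smul_eq_mul, zsmul_eq_mul, Int.cast_ofNat]
      push_cast
      ring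
    rw [hreal, Complex.norm_real, Real.norm_eq_abs, abs_mul]
    have hsd := Literature.Analysis.norm_second_difference_le (x := ν) hδ0
      (fun t _ => hasDerivAt_cutoffFreqFn he e t) (fun t _ => hasDerivAt_cutoffFreqFnD1 he e t)
      (fun t _ => by rw [Real.norm_eq_abs]; exact abs_cutoffFreqFnD2_le he e t)
    rw [Real.norm_eq_abs] at hsd
    calc |cutoffFreqFn e₀ e (ν + 2 * δ) - (2 : ℝ) • cutoffFreqFn e₀ e (ν + δ) + cutoffFreqFn e₀ e ν| * |ζ|
        ≤ δ ^ 2 * (448 / (9 * e₀ ^ 2)) * 1 := mul_le_mul hsd hζ1 (abs_nonneg _) (by positivity)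
      _ = (2 * Real.pi / β) ^ 2 * (448 / (9 * e₀ ^ 2)) := by rw [mul_one]
  · -- non-interior: each of the three values vanishes (edge frequency or padding)
    have hval : ∀ m : ℕ, m ≤ 2 → bgmGridSymbol L M N e₀ β μ K ω (q₀ + m • (fun _ : Fin 1 => (1 : ZMod N))) qv = 0 := by
      intro m hm
      by_cases hlt : ((q₀ + m • (fun _ : Fin 1 => (1 : ZMod N))) 0).val < 2 * M
      · have hv := val_add_smul_timeStep q₀ (m := m) (by omega)
        have hq : (q₀ 0).val < N := (q₀ 0).val_lt
        by_cases hw : (q₀ 0).val + m < N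
        · refine bgmGridSymbol_eq_zero_of_edge he hβ hM μ K ω (Or.inr ?_) qv
          rw [hv, Nat.mod_eq_of_lt hw] at hlt ⊢
          omega
        · refine bgmGridSymbol_eq_zero_of_edge he hβ hM μ K ω (Or.inl ?_) qv
          rw [hv, Nat.mod_eq_sub_mod (by omega), Nat.mod_eq_of_lt (by omega)]
          omega
      · unfold bgmGridSymbol; rw [dif_neg hlt]
    have h0 := hval 0 (by norm_num)
    rw [zero_smul, add_zero] at h0
    rw [hval 2 le_rfl, hval 1 (by norm_num), h0]
    simp only [smul_zero, sub_zero, add_zero, norm_zero]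
    positivity

omit [NeZero L] in
/-- The same difference written on the product torus with the step `(u, 0)` (the form of `sum_norm_charSum_le_of_second_differences`).
[cite: BenfattoGiulianiMastropietro2006, (2.36aa)] -/
theorem norm_fwdDiff_two_time_bgmGridSymbol_prod_le [NeZero N] {e₀ β : ℝ} (he : 0 < e₀) (hβ : 0 < β) (hM2 : 2 ≤ M)
    (hMN : 2 * M ≤ N) (hM : e₀ * β ≤ Real.pi * (2 * M - 3)) (μ : ℝ) (K : TrigPolyC4v) (ω : Fin (sectorCount 0))
    (q : TorusSite 1 N × TorusSite 2 L) :
    ‖(fwdDiff ((fun _ : Fin 1 => (1 : ZMod N)), (0 : TorusSite 2 L)))^[2]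
        (fun q : TorusSite 1 N × TorusSite 2 L => bgmGridSymbol L M N e₀ β μ K ω q.1 q.2) q‖ ≤
      (2 * Real.pi / β) ^ 2 * (448 / (9 * e₀ ^ 2)) := by
  have h := norm_fwdDiff_two_time_bgmGridSymbol_le he hβ hM2 hMN hM μ K ω q.1 q.2
  rw [fwdDiff_iter_two_apply] at h ⊢
  simpa [Prod.smul_mk, Prod.fst_add, Prod.snd_add] using h

end Symbol

end Literature.MathematicalPhysics.QuantumLattice

end
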